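import Summits.BirchSwinnertonDyer.BirchSwinnertonDyer.Theorems.ManinLocalTwoThreeEulerTruncationsFortyFour
import HarnessLib

/-!
# Level 52, part 2a: the Euler functions `E_δ = ∏ (1 − q^{δn})`, `δ ∣ 52`, through `q³⁹`

Cell `bsd-f2-manin`, route `ManinLocalTwoThree`, crux C2 `ManinOddAtFour` (stmt-BirchSwinnertonDyer-22967), LEAD p1 gen 24;
`--supports stmt-BirchSwinnertonDyer-22967` (helper).  The `q`-expansion input of the level-`52` pinning (an g51's TURNKEY
T-an-g51-52, residual (L2): the `σ`-closed holomorphic `η`-basis `C₁, …, C₁₀` of `M₂(Γ₀(52))` and its `q`-table at the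
columns `1, …, 8, 13, 26` (pivots) and `9, 15, 21, 39` (relations)): the remainder estimates `E_δ = P_δ(q) + o(q³⁹)` for
`δ = 1, 2, 4, 13, 26, 52` in the format of the tree's `QRemainder` calculus, coefficients from the kernel-computed table
`EulerTables.eulerTruncList_one_forty` (depth `39` because the last relation column is `39`).  Pure `q`-series bookkeeping;
nothing here proves C2, Manin's conjecture or BSD. [cite: Apostol1990, Thm. 14.3] [cite: Koehler2011, §1.1, §2.1]
-/

set_option autoImplicit false
-- lint-debt: the directory name repeats the summit name (sibling precedent `ManinLocalTwoThreeQRemainderCalculus.lean`)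
set_option linter.dupNamespace false

noncomputable section

open Complex Filter Topology Polynomial
open UpperHalfPlane hiding I
open scoped Real Topology Manifold MatrixGroups
open Literature.NumberTheory.EllipticCurves Literature.NumberTheory.EllipticCurves.ModularForms

namespace Summit.BirchSwinnertonDyer.BirchSwinnertonDyer.Theorems.ManinLocalTwoThree.LevelFiftyTwo

open QRemainder EulerTables

/-- The pentagonal table, scaled: `coeff n (∏ (1 − X^{δm})) = [δ ∣ n] · coeff_{n/δ} ∏(1 − X^m)`, evaluated from the kernel
table for `n ≤ 39`. [cite: Apostol1990, Thm. 14.3] -/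
theorem coeff_formalEulerScaled_eq_of_le_thirtyNine {δ n : ℕ} (hn : n ≤ 39) :
    PowerSeries.coeff n (formalEulerScaled δ) =
      if δ ∣ n then
        ([1, -1, -1, 0, 0, 1, 0, 1, 0, 0, 0, 0, -1, 0, 0, -1, 0, 0, 0, 0, 0, 0, 1, 0, 0, 0, 1, 0, 0, 0, 0, 0, 0, 0, 0,
          -1, 0, 0, 0, 0, -1] : List ℤ).getD (n / δ) 0
      else 0 := by
  rw [coeff_formalEulerScaled]
  split_ifs with h
  · rw [coeff_formalEulerPow_eq_getD (M := 40) ((Nat.div_le_self n δ).trans (hn.trans (by norm_num))),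
      eulerTruncList_one_forty]
  · rfl


/-- **`∏ (1 − q^{1n}) = P(q) + o(q³⁹)`**, `P` = Euler's pentagonal polynomial in `q^1` truncated at degree `39`.
[cite: Apostol1990, Thm. 14.3] -/
theorem tendsto_eulerFn_one_thirtyNine :
    Tendsto (fun τ : ℍ ↦ (eulerFn 1 τ - (1 - X - X ^ 2 + X ^ 5 + X ^ 7 - X ^ 12 - X ^ 15 + X ^ 22 + X ^ 26 - X ^ 35 : ℂ[X]).eval (Function.Periodic.qParam 1 (τ : ℂ)))
      / Function.Periodic.qParam 1 (τ : ℂ) ^ 39) atImInfty (𝓝 0) := by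
  refine congr_poly ?_ (tendsto_of_hasSum (periodic_eulerFn 1) (mdifferentiable_eulerFn 1)
    (isBoundedAtImInfty_eulerFn (by norm_num)) (hasSum_eulerFn (by norm_num)) 39)
  have h : ∀ n : ℕ, n ≤ 39 → (PowerSeries.coeff n (formalEulerScaled 1) : ℤ) =
      ([1, -1, -1, 0, 0, 1, 0, 1, 0, 0, 0, 0, -1, 0, 0, -1, 0, 0, 0, 0, 0, 0, 1, 0, 0, 0, 1, 0, 0, 0, 0, 0, 0, 0, 0, -1, 0, 0, 0, 0] : List ℤ).getD n 0 := by
    intro n hn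
    rw [coeff_formalEulerScaled_eq_of_le_thirtyNine hn]
    interval_cases n <;> decide
  simp only [Finset.sum_range_succ, Finset.sum_range_zero, h 0 (by norm_num), h 1 (by norm_num), h 2 (by norm_num), h 3 (by norm_num), h 4 (by norm_num), h 5 (by norm_num), h 6 (by norm_num), h 7 (by norm_num), h 8 (by norm_num), h 9 (by norm_num), h 10 (by norm_num), h 11 (by norm_num), h 12 (by norm_num), h 13 (by norm_num), h 14 (by norm_num), h 15 (by norm_num), h 16 (by norm_num), h 17 (by norm_num), h 18 (by norm_num), h 19 (by norm_num), h 20 (by norm_num), h 21 (by norm_num), h 22 (by norm_num), h 23 (by norm_num), h 24 (by norm_num), h 25 (by norm_num), h 26 (by norm_num), h 27 (by norm_num), h 28 (by norm_num), h 29 (by norm_num), h 30 (by norm_num), h 31 (by norm_num), h 32 (by norm_num), h 33 (by norm_num), h 34 (by norm_num), h 35 (by norm_num), h 36 (by norm_num), h 37 (by norm_num), h 38 (by norm_num), h 39 (by norm_num)]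
  norm_num
  ring

/-- **`∏ (1 − q^{2n}) = P(q) + o(q³⁹)`**, `P` = Euler's pentagonal polynomial in `q^2` truncated at degree `39`.
[cite: Apostol1990, Thm. 14.3] -/
theorem tendsto_eulerFn_two_thirtyNine :
    Tendsto (fun τ : ℍ ↦ (eulerFn 2 τ - (1 - X ^ 2 - X ^ 4 + X ^ 10 + X ^ 14 - X ^ 24 - X ^ 30 : ℂ[X]).eval (Function.Periodic.qParam 1 (τ : ℂ)))
      / Function.Periodic.qParam 1 (τ : ℂ) ^ 39) atImInfty (𝓝 0) := by
  refine congr_poly ?_ (tendsto_of_hasSum (periodic_eulerFn 2) (mdifferentiable_eulerFn 2)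
    (isBoundedAtImInfty_eulerFn (by norm_num)) (hasSum_eulerFn (by norm_num)) 39)
  have h : ∀ n : ℕ, n ≤ 39 → (PowerSeries.coeff n (formalEulerScaled 2) : ℤ) =
      ([1, 0, -1, 0, -1, 0, 0, 0, 0, 0, 1, 0, 0, 0, 1, 0, 0, 0, 0, 0, 0, 0, 0, 0, -1, 0, 0, 0, 0, 0, -1, 0, 0, 0, 0, 0, 0, 0, 0, 0] : List ℤ).getD n 0 := by
    intro n hn
    rw [coeff_formalEulerScaled_eq_of_le_thirtyNine hn]
    interval_cases n <;> decide
  simp only [Finset.sum_range_succ, Finset.sum_range_zero, h 0 (by norm_num), h 1 (by norm_num), h 2 (by norm_num), h 3 (by norm_num), h 4 (by norm_num), h 5 (by norm_num), h 6 (by norm_num), h 7 (by norm_num), h 8 (by norm_num), h 9 (by norm_num), h 10 (by norm_num), h 11 (by norm_num), h 12 (by norm_num), h 13 (by norm_num), h 14 (by norm_num), h 15 (by norm_num), h 16 (by norm_num), h 17 (by norm_num), h 18 (by norm_num), h 19 (by norm_num), h 20 (by norm_num), h 21 (by norm_num), h 22 (by norm_num), h 23 (by norm_num), h 24 (by norm_num),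 h 25 (by norm_num), h 26 (by norm_num), h 27 (by norm_num), h 28 (by norm_num), h 29 (by norm_num), h 30 (by norm_num), h 31 (by norm_num), h 32 (by norm_num), h 33 (by norm_num), h 34 (by norm_num), h 35 (by norm_num), h 36 (by norm_num), h 37 (by norm_num), h 38 (by norm_num), h 39 (by norm_num)]
  norm_num
  ring

/-- **`∏ (1 − q^{4n}) = P(q) + o(q³⁹)`**, `P` = Euler's pentagonal polynomial in `q^4` truncated at degree `39`.
[cite: Apostol1990, Thm. 14.3] -/
theorem tendsto_eulerFn_four_thirtyNine :
    Tendsto (fun τ : ℍ ↦ (eulerFn 4 τ - (1 - X ^ 4 - X ^ 8 + X ^ 20 + X ^ 28 : ℂ[X]).eval (Function.Periodic.qParam 1 (τ : ℂ)))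
      / Function.Periodic.qParam 1 (τ : ℂ) ^ 39) atImInfty (𝓝 0) := by
  refine congr_poly ?_ (tendsto_of_hasSum (periodic_eulerFn 4) (mdifferentiable_eulerFn 4)
    (isBoundedAtImInfty_eulerFn (by norm_num)) (hasSum_eulerFn (by norm_num)) 39)
  have h : ∀ n : ℕ, n ≤ 39 → (PowerSeries.coeff n (formalEulerScaled 4) : ℤ) =
      ([1, 0, 0, 0, -1, 0, 0, 0, -1, 0, 0, 0, 0, 0, 0, 0, 0, 0, 0, 0, 1, 0, 0, 0, 0, 0, 0, 0, 1, 0, 0, 0, 0, 0, 0, 0, 0, 0, 0, 0] : List ℤ).getD n 0 := by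
    intro n hn
    rw [coeff_formalEulerScaled_eq_of_le_thirtyNine hn]
    interval_cases n <;> decide
  simp only [Finset.sum_range_succ, Finset.sum_range_zero, h 0 (by norm_num), h 1 (by norm_num), h 2 (by norm_num), h 3 (by norm_num), h 4 (by norm_num), h 5 (by norm_num), h 6 (by norm_num), h 7 (by norm_num), h 8 (by norm_num), h 9 (by norm_num), h 10 (by norm_num), h 11 (by norm_num), h 12 (by norm_num), h 13 (by norm_num), h 14 (by norm_num), h 15 (by norm_num), h 16 (by norm_num), h 17 (by norm_num), h 18 (by norm_num), h 19 (by norm_num), h 20 (by norm_num), h 21 (by norm_num), h 22 (by norm_num), h 23 (by norm_num), h 24 (by norm_num), h 25 (by norm_num), h 26 (by norm_num), h 27 (by norm_num), h 28 (by norm_num), h 29 (by norm_num), h 30 (by norm_num), h 31 (by norm_num), h 32 (by norm_num), h 33 (by norm_num), h 34 (by norm_num), h 35 (by norm_num), h 36 (by norm_num), h 37 (by norm_num), h 38 (by norm_num), h 39 (by norm_num)]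
  norm_num
  ring

/-- **`∏ (1 − q^{13n}) = P(q) + o(q³⁹)`**, `P` = Euler's pentagonal polynomial in `q^13` truncated at degree `39`.
[cite: Apostol1990, Thm. 14.3] -/
theorem tendsto_eulerFn_thirteen_thirtyNine :
    Tendsto (fun τ : ℍ ↦ (eulerFn 13 τ - (1 - X ^ 13 - X ^ 26 : ℂ[X]).eval (Function.Periodic.qParam 1 (τ : ℂ)))
      / Function.Periodic.qParam 1 (τ : ℂ) ^ 39) atImInfty (𝓝 0) := by
  refine congr_poly ?_ (tendsto_of_hasSum (periodic_eulerFn 13) (mdifferentiable_eulerFn 13)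
    (isBoundedAtImInfty_eulerFn (by norm_num)) (hasSum_eulerFn (by norm_num)) 39)
  have h : ∀ n : ℕ, n ≤ 39 → (PowerSeries.coeff n (formalEulerScaled 13) : ℤ) =
      ([1, 0, 0, 0, 0, 0, 0, 0, 0, 0, 0, 0, 0, -1, 0, 0, 0, 0, 0, 0, 0, 0, 0, 0, 0, 0, -1, 0, 0, 0, 0, 0, 0, 0, 0, 0, 0, 0, 0, 0] : List ℤ).getD n 0 := by
    intro n hn
    rw [coeff_formalEulerScaled_eq_of_le_thirtyNine hn]
    interval_cases n <;> decide
  simp only [Finset.sum_range_succ, Finset.sum_range_zero, h 0 (by norm_num), h 1 (by norm_num), h 2 (by norm_num), h 3 (by norm_num), h 4 (by norm_num), h 5 (by norm_num), h 6 (by norm_num), h 7 (by norm_num), h 8 (by norm_num), h 9 (by norm_num), h 10 (by norm_num), h 11 (by norm_num), h 12 (by norm_num), h 13 (by norm_num), h 14 (by norm_num), h 15 (by norm_num), h 16 (by norm_num), h 17 (by norm_num), h 18 (by norm_num), h 19 (by norm_num), h 20 (by norm_num), h 21 (by norm_num), h 22 (by norm_num), h 23 (by norm_num), h 24 (by norm_num),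 h 25 (by norm_num), h 26 (by norm_num), h 27 (by norm_num), h 28 (by norm_num), h 29 (by norm_num), h 30 (by norm_num), h 31 (by norm_num), h 32 (by norm_num), h 33 (by norm_num), h 34 (by norm_num), h 35 (by norm_num), h 36 (by norm_num), h 37 (by norm_num), h 38 (by norm_num), h 39 (by norm_num)]
  norm_num
  ring

/-- **`∏ (1 − q^{26n}) = P(q) + o(q³⁹)`**, `P` = Euler's pentagonal polynomial in `q^26` truncated at degree `39`.
[cite: Apostol1990, Thm. 14.3] -/
theorem tendsto_eulerFn_twentySix_thirtyNine :
    Tendsto (fun τ : ℍ ↦ (eulerFn 26 τ - (1 - X ^ 26 : ℂ[X]).eval (Function.Periodic.qParam 1 (τ : ℂ)))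
      / Function.Periodic.qParam 1 (τ : ℂ) ^ 39) atImInfty (𝓝 0) := by
  refine congr_poly ?_ (tendsto_of_hasSum (periodic_eulerFn 26) (mdifferentiable_eulerFn 26)
    (isBoundedAtImInfty_eulerFn (by norm_num)) (hasSum_eulerFn (by norm_num)) 39)
  have h : ∀ n : ℕ, n ≤ 39 → (PowerSeries.coeff n (formalEulerScaled 26) : ℤ) =
      ([1, 0, 0, 0, 0, 0, 0, 0, 0, 0, 0, 0, 0, 0, 0, 0, 0, 0, 0, 0, 0, 0, 0, 0, 0, 0, -1, 0, 0, 0, 0, 0, 0, 0, 0, 0, 0, 0, 0, 0] : List ℤ).getD n 0 := by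
    intro n hn
    rw [coeff_formalEulerScaled_eq_of_le_thirtyNine hn]
    interval_cases n <;> decide
  simp only [Finset.sum_range_succ, Finset.sum_range_zero, h 0 (by norm_num), h 1 (by norm_num), h 2 (by norm_num), h 3 (by norm_num), h 4 (by norm_num), h 5 (by norm_num), h 6 (by norm_num), h 7 (by norm_num), h 8 (by norm_num), h 9 (by norm_num), h 10 (by norm_num), h 11 (by norm_num), h 12 (by norm_num), h 13 (by norm_num), h 14 (by norm_num), h 15 (by norm_num), h 16 (by norm_num), h 17 (by norm_num), h 18 (by norm_num), h 19 (by norm_num), h 20 (by norm_num), h 21 (by norm_num), h 22 (by norm_num), h 23 (by norm_num), h 24 (by norm_num), h 25 (by norm_num), h 26 (by norm_num), h 27 (by norm_num), h 28 (by norm_num), h 29 (by norm_num), h 30 (by norm_num), h 31 (by norm_num), h 32 (by norm_num), h 33 (by norm_num), h 34 (by norm_num), h 35 (by norm_num), h 36 (by norm_num), h 37 (by norm_num), h 38 (by norm_num), h 39 (by norm_num)]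
  norm_num
  ring

/-- **`∏ (1 − q^{52n}) = P(q) + o(q³⁹)`**, `P` = Euler's pentagonal polynomial in `q^52` truncated at degree `39`.
[cite: Apostol1990, Thm. 14.3] -/
theorem tendsto_eulerFn_fiftyTwo_thirtyNine :
    Tendsto (fun τ : ℍ ↦ (eulerFn 52 τ - (1 : ℂ[X]).eval (Function.Periodic.qParam 1 (τ : ℂ)))
      / Function.Periodic.qParam 1 (τ : ℂ) ^ 39) atImInfty (𝓝 0) := by
  refine congr_poly ?_ (tendsto_of_hasSum (periodic_eulerFn 52) (mdifferentiable_eulerFn 52)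
    (isBoundedAtImInfty_eulerFn (by norm_num)) (hasSum_eulerFn (by norm_num)) 39)
  have h : ∀ n : ℕ, n ≤ 39 → (PowerSeries.coeff n (formalEulerScaled 52) : ℤ) =
      ([1, 0, 0, 0, 0, 0, 0, 0, 0, 0, 0, 0, 0, 0, 0, 0, 0, 0, 0, 0, 0, 0, 0, 0, 0, 0, 0, 0, 0, 0, 0, 0, 0, 0, 0, 0, 0, 0, 0, 0] : List ℤ).getD n 0 := by
    intro n hn
    rw [coeff_formalEulerScaled_eq_of_le_thirtyNine hn]
    interval_cases n <;> decide
  simp only [Finset.sum_range_succ, Finset.sum_range_zero, h 0 (by norm_num), h 1 (by norm_num), h 2 (by norm_num), h 3 (by norm_num), h 4 (by norm_num), h 5 (by norm_num), h 6 (by norm_num), h 7 (by norm_num), h 8 (by norm_num), h 9 (by norm_num), h 10 (by norm_num), h 11 (by norm_num), h 12 (by norm_num), h 13 (by norm_num), h 14 (by norm_num), h 15 (by norm_num), h 16 (by norm_num), h 17 (by norm_num), h 18 (by norm_num), h 19 (by norm_num), h 20 (by norm_num), h 21 (by norm_num), h 22 (by norm_num), h 23 (by norm_num), h 24 (by norm_num),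 h 25 (by norm_num), h 26 (by norm_num), h 27 (by norm_num), h 28 (by norm_num), h 29 (by norm_num), h 30 (by norm_num), h 31 (by norm_num), h 32 (by norm_num), h 33 (by norm_num), h 34 (by norm_num), h 35 (by norm_num), h 36 (by norm_num), h 37 (by norm_num), h 38 (by norm_num), h 39 (by norm_num)]
  norm_num


end Summit.BirchSwinnertonDyer.BirchSwinnertonDyer.Theorems.ManinLocalTwoThree.LevelFiftyTwo

end
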